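import Mathlib
import HarnessLib
import HarnessLib.Audit
import Summits.HodgeConjecture.HodgeConjecture.Theses.KleimanBFSeeds
import Summits.HodgeConjecture.HodgeConjecture.Theses.DoublyPolarisedTransport
import Summits.HodgeConjecture.HodgeConjecture.Theorems.DoublyPolarisedSimilarAnchorsOfTwistedCube
import Summits.HodgeConjecture.HodgeConjecture.Theorems.KleimanBFSeedsWeilSimilarTrans
import Summits.HodgeConjecture.HodgeConjecture.Theorems.KleimanBFSeedsKleimanSemiregularAnchorReductions
import Summits.HodgeConjecture.HodgeConjecture.Theorems.Ring2AbelianAllWeilSimilarDiscriminant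
import Literature.AlgebraicGeometry.Motives.WeilSimilar
import Literature.AlgebraicGeometry.HodgeTheory.WeilClassesBFSheafSeedAt
import Literature.AlgebraicGeometry.HodgeTheory.ChernCharacterBettiTwistNormalised
import Literature.AlgebraicGeometry.HodgeTheory.SemiregularVariationalHodgeISemiregularCoherent

/-!
# Skeleton `Lines/lagrangian-half-descent-anchor` for the crux `TwistNormalisedKleimanSemiregularAnchorR` (K2ᵀᴿ)

HONEST REGISTER. A crux PROOF SKELETON (cruxes-workfile class, CRUX-PLAN (A)), not a proof: planning is bookkeeping;
nothing here proves the crux, `stub_good`, the rung `KleimanAnchorRungCMR 3`, (1½b′), (1½c), `WeilSixfolds`, HC_AV, HC_CM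
or HC. HC is NOT proved. Exactly FIVE `sorry`s, all inside the five declared stubs: the line's OWN two stubs
`stub_halfDescentInput_d3` and `stub_fibreTransfer_d3` (NATIVE `d = 3`, stated in their signatures) and the three stubs of
the registered line `Lines/chosen_anchor.lean` (v2.1, `stub_good` ∕ `stub_rung_CMclass_d12` ∕ `stub_rung_CMclass_d3`)
CARRIED VERBATIM (same names, same signatures) so that registering this skeleton keeps them active (one skeleton of
record per crux). Every other declaration is sorry-free and uses tree theorems only; typed ≠ proved, registered ≠ closed.

IDEA (card `Ideas/lagrangian-half-descent-anchor.md`, TRIAGE r1 pass ×2). Markman's secant sheaf for the parameter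
`q = 12` on `A = X × X̂` (`X = J(C)`, `C` a non-hyperelliptic genus-3 curve; arXiv:2509.23403 §11, p. 17) descends — with
NO twist — along the Poincaré-Lagrangian half-isogeny `ĝ : A → A♭ = A ∕ (0 ⊕ X̂[2])` to a sheaf `E♭` on `A♭`, on which
`ψ₀ := η(√−12)∕2` is an INTEGRAL endomorphism with `ψ₀² = −3`: the NATIVE `√−3`-structure (lattice certificate §4:
`weilEta_four_mul_halfIsog`, `weilEta_sq` — for every `d`, `η(√−4d)` half-descends to `η(√−d)`, Markman's remark
«`ℚ(√−q) = ℚ(√−4q)`», p. 17 L3–4, made integral). At a Zariski-general `E_ω`-cover quartic `C` (PROPOSITION A: Markman-good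
curves meet the `E_ω`-cover locus; ALPHA-SCOPE-ADD §D) the member `(A♭_C, ψ₀)` is of PRODUCT TYPE: it carries the
hyperbolic class `h₁♭` (split cell, where Markman's theorem makes the Weil class `w♭` algebraic and `E♭` is a COHERENT
Buchweitz–Flenner seed: THEOREM ♭ (i)(ii), CENSUS-6 (R4)(a) = THEOREM T for the 63 pure twists) AND a fibre direction
`θ♭` (pull-back of a point class from the CM elliptic quotient; rational, `ψ₀`-Hermitian, `θ♭ ∪ θ♭ = 0`) such that the
classes `λ·h₁♭ + f·θ♭` run through EVERY non-split `ℚ(√−3)` discriminant cell (PROPOSITION A §3.4 (iii), card K2).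
So ONE member is a junction of all cells, with the INPUT sheaf sitting at the split class; the crux at `d = 3` becomes the
TRANSFER statement `stub_fibreTransfer_d3`: on such a member a coherent seed at the split class can be moved to every
designed class `λ·h₁♭ + f·θ♭` (the fibre modification R♮ along parallel fibres `D_t = θ♭`, rows (1½b′)+(1½c) of the
companion lines `fibre-exchange-classes` ∕ `central-character-transfer`). By THEOREM F ∕ LEMMA H `E♭` itself is never a
non-split seed — it is the ANCHOR SHEAF to be modified; this line supplies the INPUT (member, class family, sheaf) at
native `d = 3` and isolates the σ-row as one named transfer stub.

CONTENTS. §0 VERBATIM COPIES of `Lines/chosen_anchor.lean` §0–§1 (`HasBFCoherentSeedAt`, `MemberwiseAtR`,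
`GoodAnchorInCellAtR`, `GoodAnchorPerClassAtR`, `GoodAnchorPerDiscriminantClassR`, `KleimanAnchorRungCMR`, the `Iff.rfl`
guard and the PROVED pointwise-Landherr lemma `memberwiseAtR_of_goodAnchorPerClassAtR`) — copied, not imported, because
the `chosen_anchor` module is not a built library leaf (farm `remote:…:unbuilt` 2026-08-31T17:2xZ); the copies are
interchangeable with the originals by `Iff.rfl`. §1 the line's statements `hClass`, `IsFibreDirection`,
`HalfDescentInputAt C d`, `FibreTransferAt C d`. §2 PROVED compositions: `goodAnchorPerClassAtR_of_halfDescent`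
(input + transfer ⟹ one good anchor per non-split cell, on ONE member), `kleimanAnchorRungCMR_of_halfDescentAt`
(⟹ the rung at that `d`), `goodAnchorPerDiscriminantClassR_of_halfDescent_all` (the d-uniform reading, AS HYPOTHESES:
the same two statements at every `d ≥ 1` would discharge `stub_good`). §3 the five stubs. §4 the lattice certificate.
§5 `kleimanAnchorRungCMR_three_of_halfDescent : KleimanAnchorRungCMR 3` (sorry-cone = the two `d = 3` stubs: THE RUNG
FED, seat ruling R19.866 (K‴)) and the composition `TwistNormalisedKleimanSemiregularAnchorR_of` concluding the crux BY
NAME (sorry-cone = `stub_good`, exactly as in `chosen_anchor`; the ∀-d crux is not claimed from the `d = 3` stubs).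

LEANS ON (unproved, named): LEMMA U (req-198: a twist-normalised Kleiman `C` agrees with the topological Chern character
on strictly perfect complexes — splitting principle from the `ChernCharacterBetti` axioms; needed to read `E♭`'s classes
through an abstract `C`), Markman arXiv:2502.03415 ∕ 2509.23403 Prop. 11.1 ∕ 11.5 (structure + semiregularity of the
secant sheaf, generic `C`), THEOREM T ∕ CENSUS-6 (R4)(a) (pure-twist Ext-vanishing, pen ×2), THEOREM ♭ (pen, ALPHA-SCOPE
§A′), PROPOSITION A (pen (P)), LEMMA DENSE (p606797), THEOREM α (p822647), X2 (p602146), Landherr (tree).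

References: [BuchweitzFlenner2003 = arXiv:math/9912245] Def. 4.1, §5 Thm. 5.1; [vanGeemen1994HodgeAV] 4.14, Lemma 5.2,
5.3–5.4; [Landherr1936HermitianForms]; [Markman2025SurveySecant = arXiv:2509.23403] §11 p. 17 (L3–4: `q ↦ 4q`; L67–68:
`8qa ≡ −1 (mod q+1)`, `q` even), Prop. 11.1, Lemma 11.3, Prop. 11.5; [Markman2025SecantWeil = arXiv:2502.03415] §9;
[Mumford1970AbelianVarieties] §23 (descent of sheaves along isogenies with Lagrangian kernel); [arXiv:2603.20268] §1.
-/

set_option linter.dupNamespace false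

noncomputable section

open CategoryTheory
open Literature.AlgebraicGeometry Literature.AlgebraicGeometry.Modules
open Literature.AlgebraicGeometry.Motives
open Literature.AlgebraicGeometry.HodgeTheory
open Literature.AlgebraicGeometry.VanGeemen1994
open Summit.HodgeConjecture.HodgeConjecture.Ring2.AbelianAll

namespace Summit.HodgeConjecture.HodgeConjecture.Cruxes.TwistNormalisedKleimanSemiregularAnchorR.LagrangianHalfDescentAnchor

/-! ### §0 Verbatim copies of `Lines/chosen_anchor.lean` §0–§1 (statements + pointwise Landherr) -/

/-- VERBATIM COPY of `ChosenAnchor.HasBFCoherentSeedAt` (the repaired seed predicate, W1): an index set `I ∋ 3`, an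
`𝒪_P`-module `E₀` GIVEN WITH a strictly perfect resolution `R`, rationals `q`, `N ≠ 0`, `c`, with `(σ_q)_{q+1 ∈ I}`
jointly injective on `Ext²(E₀,E₀)` read on `R.P` in a window `[b, 0]` (`HomComplex.IsISemiregularC`), `ch₃(R.P) = q·h³ + N·w`
and `chₚ(R.P) = cₚ·hᵖ` (`p ∈ I ∖ {3}`) for `chPerfect C P.X R.P`. [cite: BuchweitzFlenner2003, Def. 4.1, §5 (I-semiregular) and Thm. 5.1] -/
def HasBFCoherentSeedAt (C : ChernCharacterBetti) (P : AbelianVariety ℂ) (h : complexBetti P.X 2)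
    (w : complexBetti P.X (2 * 3)) : Prop :=
  ∃ (I : Finset ℕ) (E₀ : P.X.left.Modules) (R : StrictlyPerfectResolution E₀) (q N : ℚ) (c : ℕ → ℚ),
    3 ∈ I ∧ N ≠ 0 ∧
    (∃ (b : ℤ) (_ : R.P.IsStrictlyGE b), letI := HasDerivedCategory.standard P.X.left.Modules;
      HomComplex.IsISemiregularC P.X R.P b 0 R.isBoundedVB.isFiniteLocallyFree {q' | q' + 1 ∈ I}) ∧
    chPerfect C P.X R.P R.isBoundedVB.isFiniteLocallyFree 3 = ((q : ℚ) : ℂ) • cupPowTwo h 3 + ((N : ℚ) : ℂ) • w ∧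
    ∀ p' ∈ I, p' ≠ 3 → chPerfect C P.X R.P R.isBoundedVB.isFiniteLocallyFree p' = ((c p' : ℚ) : ℂ) • cupPowTwo h p'

/-- VERBATIM COPY of `ChosenAnchor.MemberwiseAtR` (K2ᵀᴿ at one `(C, d)`, the repaired route decl under its binders).
[cite: BuchweitzFlenner2003, §5 Thm. 5.1] -/
def MemberwiseAtR (C : ChernCharacterBetti) (d : ℕ) : Prop :=
  ∀ (A : AbelianVariety ℂ) (φ : A ⟶ A), A.dim = 2 * 3 → φ ≫ φ = -(d • 𝟙 A) →
    (∀ (e : ProjectiveEmbedding A.X) (a : complexBetti (projectiveSpace e.n ℂ) 2), IsRationalClass a → a ≠ 0 →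
      ¬ IsHyperbolicWeilType A φ 3
        ((d : ℂ) • complexBetti.map e.ι 2 a + complexBetti.map φ.hom.hom.hom 2 (complexBetti.map e.ι 2 a))) →
    (∃ wA : complexBetti A.X (2 * 3), wA ∈ weilClassesOf A φ 3 d ∧ wA ≠ 0 ∧
      IsOfHodgeType (2 * 3) A.X (2 * 3) 3 3 wA) →
    ∃ (eA : ProjectiveEmbedding A.X) (aA : complexBetti (projectiveSpace eA.n ℂ) 2) (P : AbelianVariety ℂ)
      (ψ₀ : P ⟶ P) (e e' : ProjectiveEmbedding P.X) (a : complexBetti (projectiveSpace e.n ℂ) 2)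
      (a' : complexBetti (projectiveSpace e'.n ℂ) 2) (w : complexBetti P.X (2 * 3)),
      IsRationalClass aA ∧ aA ≠ 0 ∧ P.dim = 2 * 3 ∧ ψ₀ ≫ ψ₀ = -(d • 𝟙 P) ∧ IsRationalClass a ∧ a ≠ 0 ∧
      IsRationalClass a' ∧ a' ≠ 0 ∧ w ∈ weilClassesOf P ψ₀ 3 d ∧ IsRationalClass w ∧ w ≠ 0 ∧
      IsOfHodgeType (2 * 3) P.X (2 * 3) 3 3 w ∧
      IsHyperbolicWeilType P ψ₀ 3 ((d : ℂ) • complexBetti.map e'.ι 2 a' + complexBetti.map ψ₀.hom.hom.hom 2 (complexBetti.map e'.ι 2 a')) ∧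
      ¬ IsHyperbolicWeilType P ψ₀ 3 ((d : ℂ) • complexBetti.map e.ι 2 a + complexBetti.map ψ₀.hom.hom.hom 2 (complexBetti.map e.ι 2 a)) ∧
      (HasWeilClassDesignAt C 3 P ((d : ℂ) • complexBetti.map e.ι 2 a + complexBetti.map ψ₀.hom.hom.hom 2 (complexBetti.map e.ι 2 a)) w → HasBFCoherentSeedAt C P ((d : ℂ) • complexBetti.map e.ι 2 a + complexBetti.map ψ₀.hom.hom.hom 2 (complexBetti.map e.ι 2 a)) w) ∧
      IsWeilSimilar 3 P ψ₀ ((d : ℂ) • complexBetti.map e.ι 2 a + complexBetti.map ψ₀.hom.hom.hom 2 (complexBetti.map e.ι 2 a)) A φ ((d : ℂ) • complexBetti.map eA.ι 2 aA + complexBetti.map φ.hom.hom.hom 2 (complexBetti.map eA.ι 2 aA))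

/-- Guard (VERBATIM COPY): the route decl K2ᵀᴿ is LITERALLY `∀ C, twist-normalised → Kleiman → ∀ d > 0, MemberwiseAtR C d`
(`Iff.rfl`). [folklore] -/
theorem twistNormalisedKleimanSemiregularAnchorR_iff :
    Summit.HodgeConjecture.HodgeConjecture.Theses.KleimanBFSeeds.TwistNormalisedKleimanSemiregularAnchorR ↔
      ∀ C : ChernCharacterBetti, C.IsTwistNormalised → C.KleimanChernNormalForm → ∀ d : ℕ, 0 < d →
        MemberwiseAtR C d :=
  Iff.rfl

/-- VERBATIM COPY of `ChosenAnchor.GoodAnchorInCellAtR` (one good anchor in the cell `δ`, repaired upgrade clause).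
[cite: vanGeemen1994HodgeAV, 4.14 and Lemma 5.2] -/
def GoodAnchorInCellAtR (C : ChernCharacterBetti) (d : ℕ) (δ : weilNormResidueGroup d) : Prop :=
  ∃ (P : AbelianVariety ℂ) (ψ₀ : P ⟶ P) (e e' : ProjectiveEmbedding P.X)
    (a : complexBetti (projectiveSpace e.n ℂ) 2) (a' : complexBetti (projectiveSpace e'.n ℂ) 2)
    (w : complexBetti P.X (2 * 3)),
    P.dim = 2 * 3 ∧ ψ₀ ≫ ψ₀ = -(d • 𝟙 P) ∧ IsRationalClass a ∧ a ≠ 0 ∧ IsRationalClass a' ∧ a' ≠ 0 ∧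
    w ∈ weilClassesOf P ψ₀ 3 d ∧ IsRationalClass w ∧ w ≠ 0 ∧ IsOfHodgeType (2 * 3) P.X (2 * 3) 3 3 w ∧
    IsHyperbolicWeilType P ψ₀ 3 ((d : ℂ) • complexBetti.map e'.ι 2 a' + complexBetti.map ψ₀.hom.hom.hom 2 (complexBetti.map e'.ι 2 a')) ∧
    HasWeilDiscriminantNondeg P ψ₀ 3 d ((d : ℂ) • complexBetti.map e.ι 2 a + complexBetti.map ψ₀.hom.hom.hom 2 (complexBetti.map e.ι 2 a)) δ ∧
    (HasWeilClassDesignAt C 3 P ((d : ℂ) • complexBetti.map e.ι 2 a + complexBetti.map ψ₀.hom.hom.hom 2 (complexBetti.map e.ι 2 a)) w → HasBFCoherentSeedAt C P ((d : ℂ) • complexBetti.map e.ι 2 a + complexBetti.map ψ₀.hom.hom.hom 2 (complexBetti.map e.ι 2 a)) w)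

/-- VERBATIM COPY of `ChosenAnchor.GoodAnchorPerClassAtR` (one good anchor per non-split cell).
[cite: vanGeemen1994HodgeAV, 5.3–5.4] [cite: Landherr1936HermitianForms] -/
def GoodAnchorPerClassAtR (C : ChernCharacterBetti) (d : ℕ) : Prop :=
  ∀ δ : weilNormResidueGroup d, weilSign d δ = (-1) ^ 3 → δ ≠ QuotientGroup.mk ((-1 : ℚˣ) ^ 3) →
    GoodAnchorInCellAtR C d δ

/-- VERBATIM COPY of `ChosenAnchor.GoodAnchorPerDiscriminantClassR` — the registered signature of `stub_good`.
[cite: BuchweitzFlenner2003, §5 Thm. 5.1] [cite: vanGeemen1994HodgeAV, 5.3–5.4] -/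
def GoodAnchorPerDiscriminantClassR : Prop :=
  ∀ C : ChernCharacterBetti, C.IsTwistNormalised → C.KleimanChernNormalForm → ∀ d : ℕ, 0 < d →
    GoodAnchorPerClassAtR C d

/-- VERBATIM COPY of `ChosenAnchor.KleimanAnchorRungCMR` — THE RUNG: K2ᵀᴿ restricted to the discriminant `d`
(`d = 3` is `stub_rung_CMclass_d3`, `d = 12` is `stub_rung_CMclass_d12`). [cite: vanGeemen1994HodgeAV, 5.3–5.4] -/
def KleimanAnchorRungCMR (d : ℕ) : Prop :=
  ∀ C : ChernCharacterBetti, C.IsTwistNormalised → C.KleimanChernNormalForm → 0 < d → MemberwiseAtR C d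

/-- VERBATIM COPY of `ChosenAnchor.memberwiseAtR_of_goodAnchorPerClassAtR` (PROVED, pointwise Landherr): the member's own
discriminant class has sign `(−1)³` and is not split, the good anchor of that class is not hyperbolic at `h(e,a)` and is
Weil-similar to the member; the upgrade clause is passed through unopened.
[cite: vanGeemen1994HodgeAV, 4.14, Lemma 5.2 (1)–(4), 5.3–5.4] [cite: Landherr1936HermitianForms] -/
theorem memberwiseAtR_of_goodAnchorPerClassAtR (C : ChernCharacterBetti) {d : ℕ} (hd : 0 < d)
    (hgood : GoodAnchorPerClassAtR C d) : MemberwiseAtR C d := by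
  intro A φ hA hφ hns hwA
  obtain ⟨wA, hwA, hwA0, hwAH⟩ := hwA
  have n3 : (0 : ℕ) < 3 := by norm_num
  have hW' : IsWeilType A φ 3 d := isWeilType_of_weilClass_ne_zero n3 hd hA hφ hwA hwA0 hwAH
  obtain ⟨eA, aA, haA, haA0, -⟩ := exists_weightedSegreEmbedding_self_prod A
  obtain ⟨δ, hδA, hsign⟩ := exists_hasWeilDiscriminantNondeg_weilSign hW' eA haA haA0
  have hne : δ ≠ QuotientGroup.mk ((-1 : ℚˣ) ^ 3) := by
    rintro rfl
    obtain ⟨-, e, a, ha, ha0, hh⟩ :=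
      Literature.AlgebraicGeometry.VanGeemen1994.IsWeilType.isSplitWeilType_of_hasWeilDiscriminantNondeg_split
        hW' eA haA haA0 hδA
    exact hns e a ha ha0 hh
  obtain ⟨P, ψ₀, e, e', a, a', w, hP, hψ, ha, ha0, ha', ha'0, hwW, hwrat, hw0, hwH, hhyp, hN, hup⟩ :=
    hgood δ hsign hne
  have hWP : IsWeilType P ψ₀ 3 d := isWeilType_of_weilClass_ne_zero n3 hd hP hψ hwW hw0 hwH
  have hnot := not_isHyperbolicWeilType_of_hasWeilDiscriminantNondeg_ne n3 hP hd hψ e ha ha0 hN hne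
  have hsim := isWeilSimilar_of_hasWeilDiscriminantNondeg hWP hW' e ha ha0 eA haA haA0 hN hδA
  exact ⟨eA, aA, P, ψ₀, e, e', a, a', w, haA, haA0, hP, hψ, ha, ha0, ha', ha'0, hwW, hwrat, hw0, hwH, hhyp,
    hnot, hup, hsim⟩

/-- VERBATIM COPY: the registered `stub_good` statement gives every rung. [cite: vanGeemen1994HodgeAV, 5.3–5.4] -/
theorem kleimanAnchorRungCMR_of_goodAnchorPerDiscriminantClassR (h : GoodAnchorPerDiscriminantClassR) (d : ℕ) :
    KleimanAnchorRungCMR d :=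
  fun C hT hK hd => memberwiseAtR_of_goodAnchorPerClassAtR C hd (h C hT hK d hd)

/-! ### §1 The line's statements (NATIVE `d`; instantiated at `d = 3` in the stubs) -/

/-- The doubly-polarised class `h(e, a) := d·e^*a + ψ₀^*(e^*a) ∈ H²(P; ℂ)` of the crux's binders (reducible
abbreviation; the §0 copies spell it out). [cite: vanGeemen1994HodgeAV, 4.14] -/
abbrev hClass (P : AbelianVariety ℂ) (ψ₀ : P ⟶ P) (d : ℕ) (e : ProjectiveEmbedding P.X)
    (a : complexBetti (projectiveSpace e.n ℂ) 2) : complexBetti P.X 2 :=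
  (d : ℂ) • complexBetti.map e.ι 2 a + complexBetti.map ψ₀.hom.hom.hom 2 (complexBetti.map e.ι 2 a)

/-- **A fibre direction** on the `√−d` member `(P, ψ₀)`: a non-zero rational `(1,1)`-class `θ` which is `ψ₀`-Hermitian
(`ψ₀^*θ = d·θ`, i.e. `H`-symmetric given `ψ₀² = −d`) and of cup-square zero — the class `θ♭` of the fibres
`D_t = Y′ × {t}` of the projection of a PRODUCT-TYPE member onto its CM elliptic quotient (card K2: `A♭_C ⊃ Y′`,
elliptic quotient of type `(0,1)`; the parallel fibres of the R♮ modification). [cite: vanGeemen1994HodgeAV, 5.3–5.4]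
[cite: Markman2025SurveySecant, §11.5] -/
def IsFibreDirection (P : AbelianVariety ℂ) (ψ₀ : P ⟶ P) (d : ℕ) (θ : complexBetti P.X 2) : Prop :=
  IsRationalClass θ ∧ θ ≠ 0 ∧ IsOfHodgeType (2 * 3) P.X 2 1 1 θ ∧
    complexBetti.map ψ₀.hom.hom.hom 2 θ = (d : ℂ) • θ ∧ cupPowTwo θ 2 = 0

/-- **`HalfDescentInputAt C d` — THE INPUT** (card K1 ∧ K2 ∧ K3 as ONE typed ∃-statement; the member is typed as the `P`
of `HasWeilClassDesignAt C 3 P h w`, TRIAGE-r1-2 sharpening): there is a `√−d` Weil sixfold `(P, ψ₀)`, `ψ₀² = −d` NATIVELY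
(at `d = 3`: `P = A♭_C = A ∕ (0 ⊕ X̂[2])`, `ψ₀ = η(√−12)∕2`, §4), with a hyperbolic doubly-polarised class `h′ = h(e′,a′)`
(the split cell), a non-zero rational `(3,3)` Weil class `w`, a fibre direction `θ` (`IsFibreDirection`), a COHERENT
Buchweitz–Flenner seed for `(h′, w)` (at `d = 3`: the half-descended secant sheaf `E♭`, simple, untwisted, `c₁ = −8h₁♭`,
Kleiman normal form with the secant's `N ≠ 0`, totally semiregular at a Zariski-general `E_ω`-cover quartic — THEOREM ♭,
THEOREM T, PROPOSITION A), and, for EVERY non-split cell `δ` of sign `(−1)³`, a doubly-polarised class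
`h(e,a) = λ·h′ + f·θ` in the pencil spanned by `h′` and `θ` whose discriminant is non-degenerate of class `δ` (card K2:
`β ↦ disc(h_{Y′} + β θ₆)` runs through `ℚˣ ∕ Nm ℚ(√−d)ˣ`; PROPOSITION A §3.4 (iii)). Why it might fail: the cell map of K2
is a Hermitian-determinant computation done abstractly for `Y × E_ω` only (U); Markman-goodness is Zariski-open but not
known at a NAMED curve (ALPHA-SCOPE §D); reading `E♭`'s classes through an abstract `C` needs LEMMA U (req-198). Size L.
[cite: Markman2025SurveySecant, §11 p. 17, Prop. 11.1 and Prop. 11.5] [cite: BuchweitzFlenner2003, §5 Thm. 5.1]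
[cite: vanGeemen1994HodgeAV, 5.3–5.4] -/
def HalfDescentInputAt (C : ChernCharacterBetti) (d : ℕ) : Prop :=
  ∃ (P : AbelianVariety ℂ) (ψ₀ : P ⟶ P) (e' : ProjectiveEmbedding P.X)
    (a' : complexBetti (projectiveSpace e'.n ℂ) 2) (w : complexBetti P.X (2 * 3)) (θ : complexBetti P.X 2),
    P.dim = 2 * 3 ∧ ψ₀ ≫ ψ₀ = -(d • 𝟙 P) ∧ IsRationalClass a' ∧ a' ≠ 0 ∧
    IsHyperbolicWeilType P ψ₀ 3 (hClass P ψ₀ d e' a') ∧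
    w ∈ weilClassesOf P ψ₀ 3 d ∧ IsRationalClass w ∧ w ≠ 0 ∧ IsOfHodgeType (2 * 3) P.X (2 * 3) 3 3 w ∧
    IsFibreDirection P ψ₀ d θ ∧
    HasBFCoherentSeedAt C P (hClass P ψ₀ d e' a') w ∧
    ∀ δ : weilNormResidueGroup d, weilSign d δ = (-1) ^ 3 → δ ≠ QuotientGroup.mk ((-1 : ℚˣ) ^ 3) →
      ∃ (e : ProjectiveEmbedding P.X) (a : complexBetti (projectiveSpace e.n ℂ) 2) (lam f : ℚ),
        IsRationalClass a ∧ a ≠ 0 ∧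
        hClass P ψ₀ d e a = ((lam : ℚ) : ℂ) • hClass P ψ₀ d e' a' + ((f : ℚ) : ℂ) • θ ∧
        HasWeilDiscriminantNondeg P ψ₀ 3 d (hClass P ψ₀ d e a) δ

/-- **`FibreTransferAt C d` — THE TRANSFER** (the σ-row, rows (1½b′)+(1½c); the hard core, shared with the companion
lines `fibre-exchange-classes` ∕ `central-character-transfer`): on a `√−d` member carrying a hyperbolic class `h′`, a
non-zero rational `(3,3)` Weil class `w`, a fibre direction `θ` and a COHERENT BF seed for `(h′, w)`, every doubly-polarised
class `h(e,a) = λ·h′ + f·θ` of the pencil with a non-degenerate NON-SPLIT discriminant at which a class-level design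
exists carries a COHERENT BF seed for `(h(e,a), w)` — the elementary modification of the input along `b − 1` parallel
fibres `D_{t_j}` (class `θ`) by rank-8 quotient packages, `c₁ ↦ c₁ − 8(b−1)θ`, re-normalised at `h(e,a)` (R♮; F1 memo
5-equation solve with free parameters; LEMMA K packages in dual Picard blocks), with `σ` still injective on `Ext²` of the
modified object. Why it might fail: THEOREM F ∕ LEMMA H ∕ ADD3 (F-ns) show the input's own `σ`-image seeds the split cell
only and B2′ v2 shows `im σ_{E′} ⊄ im σ_E` (excess 34), LEMMA S∕J give `Ext²_D(Q, E′_D) ⊇ ℂ¹⁰` trace-free — semiregularity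
of the modified object must come from a NEW mechanism (central-character transfer ∕ T-sieve), none in print; LS₄-c forces
rank ≥ 5 or a non-locally-free seed. Size XL (open). [cite: BuchweitzFlenner2003, Def. 4.1 and §5 Thm. 5.1]
[cite: Markman2025SurveySecant, Lemma 11.3 and Question 11.4] [cite: vanGeemen1994HodgeAV, 5.3–5.4] -/
def FibreTransferAt (C : ChernCharacterBetti) (d : ℕ) : Prop :=
  ∀ (P : AbelianVariety ℂ) (ψ₀ : P ⟶ P) (e' : ProjectiveEmbedding P.X)
    (a' : complexBetti (projectiveSpace e'.n ℂ) 2) (w : complexBetti P.X (2 * 3)) (θ : complexBetti P.X 2),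
    P.dim = 2 * 3 → ψ₀ ≫ ψ₀ = -(d • 𝟙 P) → IsRationalClass a' → a' ≠ 0 →
    IsHyperbolicWeilType P ψ₀ 3 (hClass P ψ₀ d e' a') →
    w ∈ weilClassesOf P ψ₀ 3 d → IsRationalClass w → w ≠ 0 → IsOfHodgeType (2 * 3) P.X (2 * 3) 3 3 w →
    IsFibreDirection P ψ₀ d θ →
    HasBFCoherentSeedAt C P (hClass P ψ₀ d e' a') w →
    ∀ (e : ProjectiveEmbedding P.X) (a : complexBetti (projectiveSpace e.n ℂ) 2) (lam f : ℚ)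
      (δ : weilNormResidueGroup d),
      IsRationalClass a → a ≠ 0 →
      hClass P ψ₀ d e a = ((lam : ℚ) : ℂ) • hClass P ψ₀ d e' a' + ((f : ℚ) : ℂ) • θ →
      weilSign d δ = (-1) ^ 3 → δ ≠ QuotientGroup.mk ((-1 : ℚˣ) ^ 3) →
      HasWeilDiscriminantNondeg P ψ₀ 3 d (hClass P ψ₀ d e a) δ →
      HasWeilClassDesignAt C 3 P (hClass P ψ₀ d e a) w → HasBFCoherentSeedAt C P (hClass P ψ₀ d e a) w

/-! ### §2 Compositions (PROVED, sorry-free) -/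

/-- **Input + transfer ⟹ one good anchor per non-split cell, all on ONE member** (the junction member of the input):
for the cell `δ` take the input's `(P, ψ₀)`, its hyperbolic class `h′`, its Weil class `w` and the pencil class `h(e,a)`
of discriminant class `δ`; the upgrade clause at `h(e,a)` is the transfer applied to the input seed at `h′`.
[cite: vanGeemen1994HodgeAV, 4.14 and 5.3–5.4] [cite: BuchweitzFlenner2003, §5 Thm. 5.1] -/
theorem goodAnchorPerClassAtR_of_halfDescent (C : ChernCharacterBetti) (d : ℕ)
    (hI : HalfDescentInputAt C d) (hT : FibreTransferAt C d) : GoodAnchorPerClassAtR C d := by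
  intro δ hsign hne
  obtain ⟨P, ψ₀, e', a', w, θ, hP, hψ, ha', ha'0, hhyp, hwW, hwrat, hw0, hwH, hθ, hseed, hcells⟩ := hI
  obtain ⟨e, a, lam, f, ha, ha0, hlin, hN⟩ := hcells δ hsign hne
  exact ⟨P, ψ₀, e, e', a, a', w, hP, hψ, ha, ha0, ha', ha'0, hwW, hwrat, hw0, hwH, hhyp, hN,
    fun hdes => hT P ψ₀ e' a' w θ hP hψ ha' ha'0 hhyp hwW hwrat hw0 hwH hθ hseed e a lam f δ ha ha0 hlin
      hsign hne hN hdes⟩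

/-- **Input + transfer at `d` (for every twist-normalised Kleiman `C`) ⟹ the rung `KleimanAnchorRungCMR d`**
(pointwise Landherr, §0). [cite: vanGeemen1994HodgeAV, 4.14, Lemma 5.2, 5.3–5.4] [cite: Landherr1936HermitianForms] -/
theorem kleimanAnchorRungCMR_of_halfDescentAt (d : ℕ)
    (hI : ∀ C : ChernCharacterBetti, C.IsTwistNormalised → C.KleimanChernNormalForm → HalfDescentInputAt C d)
    (hT : ∀ C : ChernCharacterBetti, C.IsTwistNormalised → C.KleimanChernNormalForm → FibreTransferAt C d) :
    KleimanAnchorRungCMR d :=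
  fun C hTw hK hd => memberwiseAtR_of_goodAnchorPerClassAtR C hd
    (goodAnchorPerClassAtR_of_halfDescent C d (hI C hTw hK) (hT C hTw hK))

/-- **The d-uniform reading (AS HYPOTHESES, not stubs):** the same two statements at EVERY `d ≥ 1` — available in
principle since `η(√−4d)` half-descends to an integral `η(√−d)` for every `d` (§4) and Markman's construction runs for every
even `q = 4d` (arXiv:2509.23403 p. 17 L3–4 and L67–68) — would discharge the registered `stub_good` statement. Recorded as a
sorry-free implication; this line's STUBS are the `d = 3` instances only. [cite: Markman2025SurveySecant, §11 p. 17]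
[cite: vanGeemen1994HodgeAV, 5.3–5.4] -/
theorem goodAnchorPerDiscriminantClassR_of_halfDescent_all
    (hI : ∀ C : ChernCharacterBetti, C.IsTwistNormalised → C.KleimanChernNormalForm → ∀ d : ℕ, 0 < d →
      HalfDescentInputAt C d)
    (hT : ∀ C : ChernCharacterBetti, C.IsTwistNormalised → C.KleimanChernNormalForm → ∀ d : ℕ, 0 < d →
      FibreTransferAt C d) :
    GoodAnchorPerDiscriminantClassR :=
  fun C hTw hK d hd => goodAnchorPerClassAtR_of_halfDescent C d (hI C hTw hK d hd) (hT C hTw hK d hd)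

/-- … and hence the crux itself (d-uniform reading, AS HYPOTHESES). [cite: vanGeemen1994HodgeAV, 4.14 and 5.3–5.4] -/
theorem twistNormalisedKleimanSemiregularAnchorR_of_halfDescent_all
    (hI : ∀ C : ChernCharacterBetti, C.IsTwistNormalised → C.KleimanChernNormalForm → ∀ d : ℕ, 0 < d →
      HalfDescentInputAt C d)
    (hT : ∀ C : ChernCharacterBetti, C.IsTwistNormalised → C.KleimanChernNormalForm → ∀ d : ℕ, 0 < d →
      FibreTransferAt C d) :
    Summit.HodgeConjecture.HodgeConjecture.Theses.KleimanBFSeeds.TwistNormalisedKleimanSemiregularAnchorR :=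
  fun C hTw hK d hd => memberwiseAtR_of_goodAnchorPerClassAtR C hd
    (goodAnchorPerDiscriminantClassR_of_halfDescent_all hI hT C hTw hK d hd)

/-! ### §3 The stubs (FIVE `sorry`s: two of this line at NATIVE `d = 3`, three carried verbatim from `chosen_anchor`) -/

/-- **STUB `stub_halfDescentInput_d3`** (THIS LINE, NATIVE `d = 3`; card K1 ∧ K2 ∧ K3): for every twist-normalised Kleiman
`C`, the input at `d = 3` — the member `A♭_C = A ∕ (0 ⊕ X̂[2])` of a Zariski-general `E_ω`-cover plane quartic `C` with
`ψ₀ = η(√−12)∕2`, `ψ₀² = −3` (§4), its hyperbolic class `h₁♭`, Weil class `w♭`, fibre direction `θ♭`, the half-descended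
secant sheaf `E♭` as a COHERENT BF seed at `(h₁♭, w♭)` (THEOREM ♭ (i)(ii) + THEOREM T ∕ CENSUS-6 (R4)(a) for the 63 pure
twists of `ker ĝ` + Markman Prop. 11.5 at a Markman-good curve, PROPOSITION A), and pencil classes `λ h₁♭ + f θ♭` in every
non-split `ℚ(√−3)` cell (card K2, PROPOSITION A §3.4 (iii)). Why plausibly true: lattice bookkeeping (P, triage ×2), the
63 cross summands vanish pointwise (THEOREM T, pen ×2; ALPHA-SCOPE §A′), Markman-good `E_ω`-covers exist (LEMMA DENSE +
semicontinuity, pen (P)), THEOREM α (p822647) for the split type. Why it might fail: the cell map (U), `C`-evaluation of `E♭`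
(LEMMA U, req-198), Markman-goodness only Zariski-generally on the cover locus (ALPHA-SCOPE §D). Size L.
[cite: Markman2025SurveySecant, §11 p. 17, Prop. 11.1, Prop. 11.5] [cite: BuchweitzFlenner2003, §5 Thm. 5.1]
[cite: vanGeemen1994HodgeAV, 5.3–5.4] -/
theorem stub_halfDescentInput_d3 :
    ∀ C : ChernCharacterBetti, C.IsTwistNormalised → C.KleimanChernNormalForm → HalfDescentInputAt C 3 := by
  sorry

/-- **STUB `stub_fibreTransfer_d3`** (THIS LINE, NATIVE `d = 3`; HARDEST, the σ-row (1½b′)+(1½c) on `E♭`-type input): for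
every twist-normalised Kleiman `C`, the transfer at `d = 3` — on a `√−3` member with hyperbolic `h′`, Weil class `w`, fibre
direction `θ` and a coherent seed at `(h′, w)`, every designed pencil class `λ h′ + f θ` of non-split discriminant carries a
coherent BF seed for `(·, w)`. Mechanism foreseen: R♮ elementary modification of `E♭` along `b − 1` parallel fibres of class
`θ♭` by rank-8 packages (LEMMA K: subsheaves of dual Picard blocks), Kleiman re-normalisation at `h(e,a)` (F1 5-equation
solve), semiregularity of the modified sheaf by central-character transfer ∕ the fibre-exchange T-sieve (companion lines).
Why it might fail: THEOREM F ∕ LEMMA H (σ-image of `E♯`-type inputs seeds the split cell only), B2′ v2 (`im σ_{E′} ⊄ im σ_E`,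
excess 34), LEMMA S∕J (`Ext²_D(Q,E′_D) ⊇ ℂ¹⁰` trace-free), LS₄-c; no transfer theorem in print. Size XL (open).
[cite: BuchweitzFlenner2003, Def. 4.1 and §5 Thm. 5.1] [cite: Markman2025SurveySecant, Lemma 11.3 and Question 11.4] -/
theorem stub_fibreTransfer_d3 :
    ∀ C : ChernCharacterBetti, C.IsTwistNormalised → C.KleimanChernNormalForm → FibreTransferAt C 3 := by
  sorry

/-- **STUB `stub_good`** (CARRIED VERBATIM from `Lines/chosen_anchor.lean` v2.1 — same name, same registered signature
`GoodAnchorPerDiscriminantClassR` — so that registering this skeleton keeps it active; LOAD-BEARING for the ∀-d crux):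
for every twist-normalised Kleiman `C`, every `d ≥ 1` and every non-split cell, ONE doubly-polarised anchor at which class
designs upgrade to COHERENT BF seeds. In THIS line its `d`-th instance is `goodAnchorPerClassAtR_of_halfDescent`
(input + transfer). Why it might fail: as in `chosen_anchor` (every C-evaluable coherent realisation at every anchor of some
non-split cell has `σ_I` non-injective). Size XL. [cite: BuchweitzFlenner2003, Def. 4.1 and §5 Thm. 5.1]
[cite: vanGeemen1994HodgeAV, 5.3–5.4] [cite: Markman2025SurveySecant, §3 and Lemma 11.3] -/
theorem stub_good : GoodAnchorPerDiscriminantClassR := by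
  sorry

/-- **STUB `stub_rung_CMclass_d12`** (CARRIED VERBATIM from `chosen_anchor` v2.1, registered signature
`KleimanAnchorRungCMR 12`): K2ᵀᴿ on the `d = 12` members — the native discriminant of the UNdescended secant anchors `E♯`
(CAVEAT-II §5; the companion line (A2) on `E♯` is native there). [cite: vanGeemen1994HodgeAV, 5.3–5.4]
[cite: Markman2025SurveySecant, §11 p. 17] -/
theorem stub_rung_CMclass_d12 : KleimanAnchorRungCMR 12 := by
  sorry

/-- **STUB `stub_rung_CMclass_d3`** (CARRIED VERBATIM from `chosen_anchor` v2.1, registered signature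
`KleimanAnchorRungCMR 3`): K2ᵀᴿ for `d = 3`. In THIS line the same statement is the THEOREM
`kleimanAnchorRungCMR_three_of_halfDescent` (§5; sorry-cone = the two `d = 3` stubs); the stub is kept as an independent
registered target. [cite: vanGeemen1994HodgeAV, 5.3–5.4] [cite: BuchweitzFlenner2003, §5 Thm. 5.1] -/
theorem stub_rung_CMclass_d3 : KleimanAnchorRungCMR 3 := by
  sorry

/-! ### §4 Lattice certificate of the NATIVE `d` (PROVED; toy model of `Λ_X ⊕ Λ_X̂` with `θ̃ : Λ_X̂ ≃ Λ_X`) -/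

section Lattice

variable {M : Type*} [AddCommGroup M]

/-- Markman's `η(√−q)` on `Λ_X ⊕ Λ_X̂`: `(x, z) ↦ (q·θ̃ z, −θ̃⁻¹ x)` (toy model: `t = θ̃`, `s = θ̃⁻¹` as additive maps of one
group `M`). [cite: Markman2025SurveySecant, Lemma (X × X̂ of Weil type), §11 p. 17] -/
def weilEta (q : ℤ) (t s : M →+ M) : M × M → M × M := fun p => (q • t p.2, -(s p.1))

/-- The Poincaré-Lagrangian half-isogeny read on lattices, `Λ♭ = Λ_X ⊕ ½Λ_X̂ ↪ ` coordinates `(x, z′) = (x, 2z)`: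
`(x, z) ↦ (2x, z)` (kernel `0 ⊕ X̂[2]` on the torus side; card §HalfDescent `gHalf`). [cite: Mumford1970AbelianVarieties, §23] -/
def halfIsog : M × M → M × M := fun p => ((2 : ℤ) • p.1, p.2)

/-- **Half-descent intertwines `η(√−4d)` with `2·η(√−d)`, for EVERY `d`:** `η_{4d} ∘ g = g ∘ (2 η_d)`, i.e. `η_{4d} ∕ 2`
descends along `g` to the INTEGRAL `η_d` — the native `√−d` structure; `d = 3`, `q = 12` is card B's `F12_comp_gHalf`.
[cite: Markman2025SurveySecant, §11 p. 17] -/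
theorem weilEta_four_mul_halfIsog (d : ℤ) (t s : M →+ M) (p : M × M) :
    weilEta (4 * d) t s (halfIsog p) = halfIsog ((2 : ℤ) • weilEta d t s p) := by
  obtain ⟨x, z⟩ := p
  simp only [weilEta, halfIsog, Prod.smul_mk, map_zsmul, smul_neg, smul_smul]
  refine Prod.ext ?_ ?_
  · show (4 * d) • t z = (2 * (2 * d)) • t z
    congr 1; ring
  · rfl

/-- `η(√−q)² = −q` when `θ̃⁻¹ θ̃ = θ̃ θ̃⁻¹ = id` (so the descended `η_d` has `η_d² = −d`: `ψ₀² = −3` at `d = 3`).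
[cite: Markman2025SurveySecant, §11 p. 17] -/
theorem weilEta_sq (q : ℤ) (t s : M →+ M) (hts : ∀ x, t (s x) = x) (hst : ∀ z, s (t z) = z)
    (p : M × M) : weilEta q t s (weilEta q t s p) = -(q • p) := by
  obtain ⟨x, z⟩ := p
  simp only [weilEta, map_neg, map_zsmul, hts, hst, smul_neg, Prod.smul_mk, Prod.neg_mk]

end Lattice

/-! ### §5 The rung fed at `d = 3` and the composition concluding the crux BY NAME -/

/-- **THE RUNG FED (seat ruling R19.866 (K‴)): `KleimanAnchorRungCMR 3` from the line's two `d = 3` stubs**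
(sorry-cone = `stub_halfDescentInput_d3`, `stub_fibreTransfer_d3`; NOT `stub_good`). [cite: vanGeemen1994HodgeAV, 4.14 and 5.3–5.4]
[cite: BuchweitzFlenner2003, §5 Thm. 5.1] -/
theorem kleimanAnchorRungCMR_three_of_halfDescent : KleimanAnchorRungCMR 3 :=
  kleimanAnchorRungCMR_of_halfDescentAt 3 stub_halfDescentInput_d3 stub_fibreTransfer_d3

/-- The `d = 3` ∃-core `GoodAnchorPerClassAtR C 3` from the line's two stubs (what a prover of `stub_good` gets at `d = 3`
from this line). [cite: vanGeemen1994HodgeAV, 5.3–5.4] -/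
theorem goodAnchorPerClassAtR_three_of_halfDescent (C : ChernCharacterBetti) (hTw : C.IsTwistNormalised)
    (hK : C.KleimanChernNormalForm) : GoodAnchorPerClassAtR C 3 :=
  goodAnchorPerClassAtR_of_halfDescent C 3 (stub_halfDescentInput_d3 C hTw hK) (stub_fibreTransfer_d3 C hTw hK)

/-- **Composition** (kernel-checked; `sorry`-cone = `stub_good` only, exactly as in `Lines/chosen_anchor.lean`): the
registered ∃-core gives the crux `TwistNormalisedKleimanSemiregularAnchorR` BY NAME by pointwise Landherr (§0). The ∀-d
crux is NOT claimed from the `d = 3` stubs; their d-uniform versions would give it by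
`twistNormalisedKleimanSemiregularAnchorR_of_halfDescent_all`. [cite: vanGeemen1994HodgeAV, 4.14, Lemma 5.2, 5.3–5.4]
[cite: Landherr1936HermitianForms] -/
theorem TwistNormalisedKleimanSemiregularAnchorR_of :
    Summit.HodgeConjecture.HodgeConjecture.Theses.KleimanBFSeeds.TwistNormalisedKleimanSemiregularAnchorR := by
  have hgood : GoodAnchorPerDiscriminantClassR := stub_good
  intro C hT hK d hd
  exact memberwiseAtR_of_goodAnchorPerClassAtR C hd (hgood C hT hK d hd)

end Summit.HodgeConjecture.HodgeConjecture.Cruxes.TwistNormalisedKleimanSemiregularAnchorR.LagrangianHalfDescentAnchor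

end
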